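import Literature.Probability.LatticeModels.MTP2FourFunctions
import Mathlib.MeasureTheory.Constructions.UnitInterval
import Mathlib.Topology.Order.ProjIcc
import HarnessLib

/-!
# Karlin–Rinott (1980), Theorem 2.1 on the unit square `[0,1]²` with Lebesgue measure

CITATION HEADER.  Source: S. Karlin, Y. Rinott, *Classes of orderings of measures and related correlation
inequalities. I. Multivariate totally positive distributions*, J. Multivariate Anal. **10** (1980) 467–498
[KarlinRinott1980], Thm. 2.1 (p. 470): "Let `f₁, f₂, f₃, f₄` be nonnegative functions on `𝒳 = ∏ 𝒳ᵢ`
satisfying for all `x, y ∈ 𝒳`: `f₁(x) f₂(y) ≤ f₃(x ∨ y) f₄(x ∧ y)` (2.1).  Then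
`∫ f₁ dσ ∫ f₂ dσ ≤ ∫ f₃ dσ ∫ f₄ dσ` (2.2)" (`σ` a product of σ-finite measures on the totally ordered
factors `𝒳ᵢ`).  Companion of `MTP2FourFunctions.lean`, where the theorem is proved for `ℝ^ι` with an
arbitrary product of σ-finite measures (`lintegral_four_functions`).

## What is here (one theorem; no definition of substance, no named fact)

`lintegral_four_functions_unitSquare` — **Thm. 2.1 for `𝒳 = [0,1] × [0,1]` with Lebesgue measure**
(`volume` on `unitInterval × unitInterval`), `[0,∞]`-valued measurable `fⱼ`:
`(∫⁻ f₁)(∫⁻ f₂) ≤ (∫⁻ f₃)(∫⁻ f₄)`.  It is the instance `ι = Fin 2`, `μᵢ = λ|_{[0,1]}` of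
`lintegral_four_functions`, transported along the clamp `ℝ² → [0,1]²` (a lattice homomorphism, so
hypothesis (2.1) transports) and the measure-preserving identifications
`(Fin 2 → ℝ, ⊗ λ|_{[0,1]}) ≅ (ℝ², (λ⊗λ)|_{[0,1]²}) ≅ ([0,1]², λ)`.

Motivation (this programme, cell prim-sahi, crux `stmt-CriticalPhenomena-4575`): the FKG lattice condition of
an MTP₂ density on the square passes to the masses of the cells of any product grid (used Summits-side for
Sahi's inequalities under absolutely continuous FKG measures on `[0,1]²`).
-/

noncomputable section

open MeasureTheory ENNReal Set
open scoped unitInterval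

namespace Literature.Probability.LatticeModels

namespace UnitSquareFourFunctions

/-- The clamp `ℝ² → [0,1]²`, `(s,t) ↦ (π(s), π(t))`, `π` the projection onto `[0,1]` (plumbing). [folklore] -/
def clamp (p : ℝ × ℝ) : I × I := (projIcc 0 1 zero_le_one p.1, projIcc 0 1 zero_le_one p.2)

/-- The clamp is measurable (plumbing). [folklore] -/
private theorem measurable_clamp : Measurable clamp :=
  (continuous_projIcc.comp continuous_fst).measurable.prodMk
    (continuous_projIcc.comp continuous_snd).measurable

/-- The clamp preserves `⊔` (plumbing). [folklore] -/
private theorem clamp_sup (p q : ℝ × ℝ) : clamp (p ⊔ q) = clamp p ⊔ clamp q :=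
  have h := fun a b : ℝ => (monotone_projIcc (a := (0 : ℝ)) (b := 1) zero_le_one).map_sup a b
  Prod.ext (h p.1 q.1) (h p.2 q.2)

/-- The clamp preserves `⊓` (plumbing). [folklore] -/
private theorem clamp_inf (p q : ℝ × ℝ) : clamp (p ⊓ q) = clamp p ⊓ clamp q :=
  have h := fun a b : ℝ => (monotone_projIcc (a := (0 : ℝ)) (b := 1) zero_le_one).map_inf a b
  Prod.ext (h p.1 q.1) (h p.2 q.2)

/-- The clamp is the identity on the square (plumbing). [folklore] -/
private theorem clamp_coe (x : I × I) : clamp ((x.1 : ℝ), (x.2 : ℝ)) = x :=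
  Prod.ext (projIcc_val zero_le_one x.1) (projIcc_val zero_le_one x.2)

/-- The inclusion `[0,1]² ↪ ℝ²` pushes Lebesgue measure of the square to `(λ|_{[0,1]}) ⊗ (λ|_{[0,1]})`
(plumbing). [folklore] -/
private theorem measurePreserving_incl :
    MeasurePreserving (Prod.map Subtype.val Subtype.val : I × I → ℝ × ℝ) (volume : Measure (I × I))
      (((volume : Measure ℝ).restrict (Icc 0 1)).prod ((volume : Measure ℝ).restrict (Icc 0 1))) := by
  rw [Measure.volume_eq_prod]
  exact unitInterval.measurePreserving_coe.prod unitInterval.measurePreserving_coe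

/-- Transport of a Lebesgue integral over the square to `(Fin 2 → ℝ, ⊗ λ|_{[0,1]})` along the clamp
(plumbing). [folklore] -/
private theorem lintegral_clamp {g : I × I → ℝ≥0∞} (hg : Measurable g) :
    ∫⁻ x, g (clamp (x 0, x 1)) ∂(Measure.pi fun _ : Fin 2 => (volume : Measure ℝ).restrict (Icc 0 1)) =
      ∫⁻ p, g p ∂(volume : Measure (I × I)) := by
  have h1 : ∫⁻ x, g (clamp (x 0, x 1)) ∂(Measure.pi fun _ : Fin 2 => (volume : Measure ℝ).restrict (Icc 0 1)) =
      ∫⁻ y, g (clamp y) ∂(((volume : Measure ℝ).restrict (Icc 0 1)).prod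
        ((volume : Measure ℝ).restrict (Icc 0 1))) :=
    (measurePreserving_finTwoArrow ((volume : Measure ℝ).restrict (Icc 0 1))).lintegral_comp
      (f := fun y : ℝ × ℝ => g (clamp y)) (hg.comp measurable_clamp)
  have h2 := measurePreserving_incl.lintegral_comp (f := fun y : ℝ × ℝ => g (clamp y))
    (hg.comp measurable_clamp)
  rw [h1, ← h2]
  refine lintegral_congr fun x => ?_
  show g (clamp ((x.1 : ℝ), (x.2 : ℝ))) = g x
  rw [clamp_coe]

end UnitSquareFourFunctions

open UnitSquareFourFunctions

/-- **Karlin–Rinott's Theorem 2.1 (continuous four functions theorem) on the unit square with Lebesgue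
measure**: if measurable `f₁, f₂, f₃, f₄ : [0,1]² → [0,∞]` satisfy `f₁(p) f₂(q) ≤ f₃(p ∨ q) f₄(p ∧ q)` for all
`p, q`, then `(∫ f₁)(∫ f₂) ≤ (∫ f₃)(∫ f₄)` (Lebesgue integrals over `[0,1]²`).
[cite: KarlinRinott1980, Thm. 2.1 (𝒳 = [0,1]², σ = Lebesgue)] -/
theorem lintegral_four_functions_unitSquare (f₁ f₂ f₃ f₄ : I × I → ℝ≥0∞) (hm₁ : Measurable f₁)
    (hm₂ : Measurable f₂) (hm₃ : Measurable f₃) (hm₄ : Measurable f₄)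
    (h : ∀ p q, f₁ p * f₂ q ≤ f₃ (p ⊔ q) * f₄ (p ⊓ q)) :
    (∫⁻ p, f₁ p ∂(volume : Measure (I × I))) * (∫⁻ p, f₂ p ∂(volume : Measure (I × I))) ≤
      (∫⁻ p, f₃ p ∂(volume : Measure (I × I))) * (∫⁻ p, f₄ p ∂(volume : Measure (I × I))) := by
  have hmc : ∀ {g : I × I → ℝ≥0∞}, Measurable g → Measurable fun x : Fin 2 → ℝ => g (clamp (x 0, x 1)) :=
    fun hg => (hg.comp measurable_clamp).comp ((measurable_pi_apply 0).prodMk (measurable_pi_apply 1))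
  have key := lintegral_four_functions (fun _ : Fin 2 => (volume : Measure ℝ).restrict (Icc 0 1))
    (fun x => f₁ (clamp (x 0, x 1))) (fun x => f₂ (clamp (x 0, x 1))) (fun x => f₃ (clamp (x 0, x 1)))
    (fun x => f₄ (clamp (x 0, x 1))) (hmc hm₁) (hmc hm₂) (hmc hm₃) (hmc hm₄) (fun x y => by
      have hs : clamp ((x ⊔ y) 0, (x ⊔ y) 1) = clamp (x 0, x 1) ⊔ clamp (y 0, y 1) := by
        rw [← clamp_sup]; rfl
      have hi : clamp ((x ⊓ y) 0, (x ⊓ y) 1) = clamp (x 0, x 1) ⊓ clamp (y 0, y 1) := by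
        rw [← clamp_inf]; rfl
      rw [hs, hi]
      exact h _ _)
  rwa [lintegral_clamp hm₁, lintegral_clamp hm₂, lintegral_clamp hm₃, lintegral_clamp hm₄] at key

end Literature.Probability.LatticeModels
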